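import Mathlib
import Summits.Ventures.PercRepro2.HCov
import Summits.Ventures.PercRepro2.CCTRootEdge
import Summits.Ventures.PercRepro2.EdgeCubic
import Summits.Ventures.PercRepro2.CPolarA3
import Summits.Ventures.PercRepro2.CPolarA3Marks

/-!
# A PENDANT `a₃`-CLUSTER: the pinned-open reach of `a₃` has a single fractional boundary edge —
the events at the two pins, almost surely (blind cell PercRepro2, p5 g15; `proofs/P5-OEDGE.md` §17)

Let `K = pinnedReach p ends a₃` be mark-free (`MarkFree`), let `f = {z, u}` with `z ∈ K`, `u ∉ K`, and let
`f` be the ONLY fractional edge touching `K` (`hK`). This is the contracted form of «`a₃` a leaf at `u`»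
(PendantA3Pins.lean): on every configuration of positive weight,

* connections between vertices outside `K` do not see the pin of `f` (`conn_update_iff_outside`:
  a path through `f` would have to leave `K` through a second open boundary edge, and every other
  boundary edge of `K` has weight `0`);
* with `f` closed the cluster of `a₃` is `K` (`not_conn_update_false_a3`), with `f` open `a₃ ↔ u`
  (`conn_update_true_a3_u`).

`FreeAE p f X` records that `X` does not see the pin on positive-weight configurations
(`freeAE_connEvent`, `FreeAE.inter`, `freeAE_Q`); `prob_zero_PD_ae` … `prob_one_Q_ae` are the
almost-sure twins of PendantA3Pins' `prob_zero_*` / `prob_one_*`: at `p[f↦0]` the masses of `PD`,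
`T`, `T′` collapse onto `Q`, `∅`, `∅`, at `p[f↦1]` onto the worlds `PD_u`, `T_u`, `T′_u` of the instance
with `a₃ := u`. The Bernstein coefficients follow in PendantClusterBern.lean.
-/

namespace Summit.Ventures.PercRepro2

open UnionCluster CovForm CovForm.CPolarA3

namespace PendantCluster

section Conn

variable {V : Type*} {E : Type*} [Fintype E] [DecidableEq E] {R : Type*} [Field R]
  [LinearOrder R]

variable {p : E → R} {ends : E → Sym2 V} {f : E} {a₃ z u : V}

omit [LinearOrder R] in
/-- Pinning `f` closed in both the weights and the configuration keeps the weight nonzero. -/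
lemma weight_update_zero_ne_zero {ω : Config E} (hw : weight p ω ≠ 0) :
    weight (Function.update p f 0) (Function.update ω f false) ≠ 0 := by
  have hprod : (∏ e' ∈ Finset.univ.erase f, edgeFactor (p e') (ω e')) ≠ 0 := by
    intro h
    apply hw
    rw [weight_eq_mul_edgeFactor p ω f, h, zero_mul]
  rw [weight_eq_mul_edgeFactor, prod_erase_update_left, prod_erase_update_right]
  simp only [Function.update_self, edgeFactor_false, sub_zero, mul_one]
  exact hprod

omit [Fintype E] in
/-- The pinned configuration does not change when a fractional edge is pinned CLOSED. -/
lemma pinnedConfig_update_zero (hf1 : p f ≠ 1) :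
    pinnedConfig (Function.update p f 0) = pinnedConfig p := by
  funext e
  unfold pinnedConfig
  by_cases he : e = f
  · subst he
    simp [hf1]
  · simp [Function.update_of_ne he]

omit [Fintype E] in
/-- The reach of `a₃` does not change when a fractional edge is pinned CLOSED. -/
lemma pinnedReach_update_zero (hf1 : p f ≠ 1) :
    pinnedReach (Function.update p f 0) ends a₃ = pinnedReach p ends a₃ := by
  unfold pinnedReach
  rw [pinnedConfig_update_zero hf1]

omit [Fintype E] in
/-- Pinned OPEN, the reach of `a₃` contains the outer end of `f` (the inner end being in the reach). -/
lemma mem_pinnedReach_update_one (hf : ends f = s(z, u)) (hz : z ∈ pinnedReach p ends a₃) :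
    u ∈ pinnedReach (Function.update p f 1) ends a₃ := by
  have hle : pinnedConfig p ≤ pinnedConfig (Function.update p f 1) := by
    intro e
    unfold pinnedConfig
    by_cases he : e = f
    · subst he; simp
    · simp [Function.update_of_ne he]
  have hz' : Conn ends (pinnedConfig (Function.update p f 1)) a₃ z := conn_mono hle hz
  have hzu : OpenAdj ends (pinnedConfig (Function.update p f 1)) z u := by
    refine ⟨f, ?_, hf⟩
    unfold pinnedConfig
    simp
  exact conn_trans hz' (conn_of_openAdj hzu)

/-- With `f` pinned closed, no fractional edge touches the reach of `a₃` (when `f` was the only one). -/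
lemma no_frac_touches_update_zero (hK : ∀ e ∈ fracEdges p, TouchesReach p ends a₃ e → e = f)
    (hf1 : p f ≠ 1) :
    ∀ e ∈ fracEdges (Function.update p f 0), ¬ TouchesReach (Function.update p f 0) ends a₃ e := by
  intro e he ht
  rw [fracEdges_update p f 0 (Or.inl rfl)] at he
  have hne : e ≠ f := Finset.ne_of_mem_erase he
  have he' : e ∈ fracEdges p := Finset.mem_of_mem_erase he
  rw [TouchesReach, pinnedReach_update_zero hf1] at ht
  exact hne (hK e he' ht)

/-- **Connections outside the reach do not see the pin of `f`**: for `x, y ∉ K` and a configuration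
of positive weight, `x ↔ y` with `f` open implies `x ↔ y` with `f` closed (the converse is
monotonicity). -/
lemma conn_update_false_of_true (hK : ∀ e ∈ fracEdges p, TouchesReach p ends a₃ e → e = f)
    (hf : ends f = s(z, u)) (hz : z ∈ pinnedReach p ends a₃) (hu : u ∉ pinnedReach p ends a₃)
    (hf1 : p f ≠ 1) {ω : Config E} (hw : weight p ω ≠ 0) {x y : V}
    (hx : x ∉ pinnedReach p ends a₃) (hy : y ∉ pinnedReach p ends a₃)
    (h : Conn ends (Function.update ω f true) x y) : Conn ends (Function.update ω f false) x y := by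
  set ω₀ := Function.update ω f false with hω₀
  have hw₀ : weight (Function.update p f 0) ω₀ ≠ 0 := weight_update_zero_ne_zero hw
  -- with `f` closed the cluster of `a₃` is `K`
  have hclus : ∀ v, Conn ends ω₀ a₃ v → v ∈ pinnedReach p ends a₃ := by
    intro v hv
    have := conn_mem_pinnedReach (p := Function.update p f 0) (ends := ends) (a₃ := a₃)
      (no_frac_touches_update_zero hK hf1) hw₀ hv
    rwa [pinnedReach_update_zero hf1] at this
  have hK_conn : ∀ v ∈ pinnedReach p ends a₃, Conn ends ω₀ a₃ v := by
    intro v hv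
    have hle : pinnedConfig (Function.update p f 0) ≤ ω₀ := pinnedConfig_le_of_weight_ne_zero hw₀
    rw [pinnedConfig_update_zero hf1] at hle
    exact conn_mono hle hv
  -- the closed set
  let S : Set V := {v | Conn ends ω₀ x v ∨ (v ∈ pinnedReach p ends a₃ ∧ Conn ends ω₀ x u)}
  have hxS : x ∈ S := Or.inl (conn_refl ends ω₀ x)
  have hS : ∀ v ∈ S, ∀ w, (openGraph ends (Function.update ω f true)).Adj v w → w ∈ S := by
    intro v hv w hvw
    obtain ⟨_, e, he, hends⟩ := openGraph_adj.1 hvw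
    by_cases hef : e = f
    · -- the edge is `f = {z, u}`
      subst hef
      rw [hf] at hends
      have hvw' : (v = z ∧ w = u) ∨ (v = u ∧ w = z) := by
        have := Sym2.eq_iff.1 hends
        tauto
      rcases hvw' with ⟨hv', hw'⟩ | ⟨hv', hw'⟩
      · -- `v = z ∈ K`: `v ∈ S` forces `x ↔ u` in `ω₀`
        rw [hw']; rw [hv'] at hv
        rcases hv with hv | ⟨_, hxu⟩
        · -- `x ↔ z` with `z ∈ K` is impossible for `x ∉ K`
          exact absurd (hclus x (conn_trans (hK_conn z hz) (conn_symm hv))) hx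
        · exact Or.inl hxu
      · rw [hw']; rw [hv'] at hv
        rcases hv with hv | ⟨huK, _⟩
        · exact Or.inr ⟨hz, hv⟩
        · exact absurd huK hu
    · -- an edge other than `f` has the same state in `ω₀`
      have he₀ : ω₀ e = true := by
        rw [hω₀, Function.update_of_ne hef]
        rwa [Function.update_of_ne hef] at he
      rcases hv with hv | ⟨hvK, hxu⟩
      · exact Or.inl (conn_trans hv (conn_of_openAdj ⟨e, he₀, hends⟩))
      · -- an open edge at `v ∈ K` in a positive-weight configuration stays inside `K`
        have hwK : w ∈ pinnedReach p ends a₃ :=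
          hclus w (conn_trans (hK_conn v hvK) (conn_of_openAdj ⟨e, he₀, hends⟩))
        exact Or.inr ⟨hwK, hxu⟩
  have hyS : y ∈ S := mem_of_conn_of_closed hS hxS h
  rcases hyS with hyS | ⟨hyK, _⟩
  · exact hyS
  · exact absurd hyK hy

end Conn

section AE

variable {V : Type*} {E : Type*} [Fintype E] [DecidableEq E] {R : Type*} [Field R]
  [LinearOrder R]

variable {p : E → R} {ends : E → Sym2 V} {f : E} {a₃ z u : V}

omit [Fintype E] [LinearOrder R] in
/-- `ω[f↦false] ≤ ω ≤ ω[f↦true]`. -/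
lemma update_false_le (ω : Config E) (f : E) : Function.update ω f false ≤ ω := by
  intro e
  by_cases he : e = f
  · subst he; simp
  · simp [Function.update_of_ne he]

omit [Fintype E] [LinearOrder R] in
/-- `ω ≤ ω[f↦true]`. -/
lemma le_update_true (ω : Config E) (f : E) : ω ≤ Function.update ω f true := by
  intro e
  by_cases he : e = f
  · subst he; simp
  · simp [Function.update_of_ne he]

/-- **Connections outside the reach do not see the pin of `f`** (both directions, either pin). -/
lemma conn_update_iff (hK : ∀ e ∈ fracEdges p, TouchesReach p ends a₃ e → e = f)
    (hf : ends f = s(z, u)) (hz : z ∈ pinnedReach p ends a₃) (hu : u ∉ pinnedReach p ends a₃)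
    (hf1 : p f ≠ 1) {ω : Config E} (hw : weight p ω ≠ 0) {x y : V}
    (hx : x ∉ pinnedReach p ends a₃) (hy : y ∉ pinnedReach p ends a₃) (c : Bool) :
    Conn ends (Function.update ω f c) x y ↔ Conn ends ω x y := by
  have key := conn_update_false_of_true hK hf hz hu hf1 hw hx hy
  have h1 : Function.update ω f c ≤ Function.update ω f true := by
    intro e
    by_cases he : e = f
    · subst he; simp
    · simp [Function.update_of_ne he]
  have h2 : Function.update ω f false ≤ Function.update ω f c := by
    intro e
    by_cases he : e = f
    · subst he; simp
    · simp [Function.update_of_ne he]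
  constructor
  · intro h
    exact conn_mono (update_false_le ω f) (key (conn_mono h1 h))
  · intro h
    exact conn_mono h2 (key (conn_mono (le_update_true ω f) h))

/-- With `f` closed, the leaf cluster `K` is joined to nothing outside it. -/
lemma not_conn_update_false_a3 (hK : ∀ e ∈ fracEdges p, TouchesReach p ends a₃ e → e = f)
    (hf1 : p f ≠ 1) {ω : Config E} (hw : weight p ω ≠ 0) {v : V} (hv : v ∉ pinnedReach p ends a₃) :
    ¬ Conn ends (Function.update ω f false) a₃ v := by
  intro h
  have hw₀ : weight (Function.update p f 0) (Function.update ω f false) ≠ 0 :=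
    weight_update_zero_ne_zero hw
  have := conn_mem_pinnedReach (p := Function.update p f 0) (ends := ends) (a₃ := a₃)
    (no_frac_touches_update_zero hK hf1) hw₀ h
  rw [pinnedReach_update_zero hf1] at this
  exact hv this

omit [LinearOrder R] in
/-- Pinning `f` open in both the weights and the configuration keeps the weight nonzero. -/
lemma weight_update_one_ne_zero {ω : Config E} (hw : weight p ω ≠ 0) :
    weight (Function.update p f 1) (Function.update ω f true) ≠ 0 := by
  have hprod : (∏ e' ∈ Finset.univ.erase f, edgeFactor (p e') (ω e')) ≠ 0 := by
    intro h
    apply hw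
    rw [weight_eq_mul_edgeFactor p ω f, h, zero_mul]
  rw [weight_eq_mul_edgeFactor, prod_erase_update_left, prod_erase_update_right]
  simp only [Function.update_self, edgeFactor_true, mul_one]
  exact hprod

/-- With `f` open, `a₃ ↔ u` on every configuration of positive weight. -/
lemma conn_update_true_a3_u (hf : ends f = s(z, u)) (hz : z ∈ pinnedReach p ends a₃)
    {ω : Config E} (hw : weight p ω ≠ 0) : Conn ends (Function.update ω f true) a₃ u :=
  conn_of_mem_pinnedReach (weight_update_one_ne_zero hw) (mem_pinnedReach_update_one hf hz)

/-- `X` does not see the pin of `f` on the configurations of positive weight. -/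
def FreeAE (p : E → R) (f : E) (X : Set (Config E)) : Prop :=
  ∀ ω : Config E, weight p ω ≠ 0 → ∀ c : Bool, (Function.update ω f c ∈ X ↔ ω ∈ X)

omit [LinearOrder R] in
/-- Free events are closed under intersection. -/
lemma FreeAE.inter {X Y : Set (Config E)} (hX : FreeAE p f X) (hY : FreeAE p f Y) :
    FreeAE p f (X ∩ Y) := fun ω hw c => and_congr (hX ω hw c) (hY ω hw c)

omit [LinearOrder R] in
/-- The whole space is free. -/
lemma FreeAE.univ : FreeAE p f (Set.univ : Set (Config E)) := fun _ _ _ => by simp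

/-- A connection between two vertices outside the reach is free of the pin. -/
lemma freeAE_connEvent (hK : ∀ e ∈ fracEdges p, TouchesReach p ends a₃ e → e = f)
    (hf : ends f = s(z, u)) (hz : z ∈ pinnedReach p ends a₃) (hu : u ∉ pinnedReach p ends a₃)
    (hf1 : p f ≠ 1) {x y : V} (hx : x ∉ pinnedReach p ends a₃) (hy : y ∉ pinnedReach p ends a₃) :
    FreeAE p f (connEvent ends x y) := by
  intro ω hw c
  simp only [mem_connEvent]
  exact conn_update_iff hK hf hz hu hf1 hw hx hy c

/-- `Q` is free of the pin (the roots are outside the reach). -/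
lemma freeAE_Q (hK : ∀ e ∈ fracEdges p, TouchesReach p ends a₃ e → e = f)
    (hf : ends f = s(z, u)) (hz : z ∈ pinnedReach p ends a₃) (hu : u ∉ pinnedReach p ends a₃)
    (hf1 : p f ≠ 1) {a₁ a₂ : V} (h1 : a₁ ∉ pinnedReach p ends a₃) (h2 : a₂ ∉ pinnedReach p ends a₃) :
    FreeAE p f (avoidAll ends a₂ {a₁}) := by
  intro ω hw c
  simp only [mem_avoidAll, Finset.mem_singleton, forall_eq]
  exact not_congr (conn_update_iff hK hf hz hu hf1 hw h2 h1 c)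

end AE


end PendantCluster

end Summit.Ventures.PercRepro2
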